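import Summits.CriticalPhenomena.CardyFormulaZ2.Theorems.CardyComplexConeParafermionToSLESixFamiliesIicTouchLawPin
import Summits.CriticalPhenomena.CardyFormulaZ2.Theorems.CardyComplexConeParafermionToSLESixFamiliesFlipDefs
import HarnessLib

/-!
# Vocabulary of line `potential-darboux-picard-diamond` for crux `ParafermionToSLESixFamilies` (stmt-CriticalPhenomena-11389)

Route `CardyComplexCone` (sub-problem `CriticalPhenomena/CardyFormulaZ2`), crux
`Summit.CriticalPhenomena.CardyFormulaZ2.Theses.CardyComplexCone.ParafermionToSLESixFamilies` (literally
`WeakHolFamilies → PrecompactFamilies → SLESixAllFamilies`, the three blocks of `…IicDefs.lean`). This file is the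
**definitions module** of the checked skeleton `Cruxes/ParafermionToSLESixFamilies/Lines/potential_darboux_picard_diamond.lean`
(planner `planner-cruxplan-stmt-CriticalPhenomena-11389-potential-darboux-pi-0`, lead
`prover-line-stmt-CriticalPhenomena-11389-c5-0`): it carries, sorry-free and verbatim from the skeleton, the line's VOCABULARY —
the class weights and exact potential pairs of the closed spin-`1/3` corner form on the interior site–face complex
(`classWeight`, `IsExactPair`, `IsCell`, `ctr`), marked diamonds and their oriented boundary segments (`IsMarkedDiamond`,
`IsBdrySegment`, `proj`, `sideCells`, `rayDist`, `touchMass`, `markInd`), and the typed STATEMENTS of the line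
(`ExactPotentialTrace` = S1, `DarbouxPicardConvex` / `TraceWindingNonneg` = S2, `IsPotentialLimit`, `ClosedPrecompactness` = S3,
`PotentialConformalLimit` = conclusion of S4, `DiagTouchLawPosPin` = conclusion of S5) — so that the stub helper files
`Theorems/CardyComplexConeParafermionToSLESixFamiliesDiamond<Stub>.lean` (each proving `theorem stub_<x> : <signature>` by name,
`--supports stmt-CriticalPhenomena-11389`) and the closing skeleton share ONE copy of every object. NOTHING here is asserted:
every `def … : Prop` is a stub statement or a hypothesis/conclusion of one (`ClosedPrecompactness` and `DiagTouchLawPosPin` are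
acknowledged research inputs of conjecture strength; `DarbouxPicardConvex`, `TraceWindingNonneg` are classical complex analysis —
Darboux's theorem and the argument principle for boundary traces — to be PROVED in the stub file of S2, not cited). The one
theorem is the non-vacuity check `norm_classWeight_of_isCorner` (the weights are unimodular on the four corner classes).

Lead's reshape w.r.t. the planner's skeleton (vocabulary only; every statement is otherwise byte-identical): the all-diagonal
geometry `IsDiagDir`, `IsDiagFreeWindow`, `IsDiagRectilinear`, `IdentOnDiagRectilinear` is NOT re-declared — the landed twins of
`…FlipDefs.lean` (namespace `…FlipInvolutionReturnLaw`, p133495) are used, so that the endgame stubs S6/S7 of this line and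
`stub_identDiag` / `stub_allDomainsOfDiag` of line `flip-involution-return-law` speak one language and the landed glue
`FlipInvolutionReturnLaw.allDomainsOfDiag_of` applies verbatim. (`FlipDefs.IsDiagDir` lists the four diagonal unit vectors as
`(±1 ± i)/√2`; the skeleton wrote them as `exp(kπi/4)`, the same four numbers.)

Sources: H. Duminil-Copin, S. Smirnov, *Conformal invariance of lattice models*, arXiv:1109.1549, §8 (Prop. 8.6, Conj. 8.7);
H. Duminil-Copin, *Parafermionic observables and their applications to planar statistical physics models*, Ensaios Mat. 25
(2013), Props. 4–5; R. P. Boas, *Invitation to Complex Analysis* (2010) §13D ("Darboux's theorem"); Ch. Pommerenke, *Boundary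
Behaviour of Conformal Maps* (1992) §2; Y. Ikhlef, A. Ponsaing, J. Phys. A 45 (2012).
-/

noncomputable section

namespace Summit.CriticalPhenomena.CardyFormulaZ2.Cruxes.ParafermionToSLESixFamilies.PotentialDarbouxPicardDiamond

open scoped Topology NNReal ENNReal BigOperators
open Filter MeasureTheory Set Metric Complex
open UpperHalfPlane (upperHalfPlaneSet)
open Literature.Probability Literature.Probability.LatticeModels Literature.Probability.Percolation
open Literature.Probability.LatticeModels.DiscreteDobrushin
open Literature.Probability.RandomPlanarGeometry
open Summit.CriticalPhenomena.CardyFormulaZ2.Cruxes.EdgePrecompact.QkzStripBoundaryArm (cornerObs)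
open Summit.CriticalPhenomena.CardyFormulaZ2.Cruxes.ParafermionToSLESixFamilies.CaratheodoryNetSlitUniformity
  (revealedFreeEdges)
open Summit.CriticalPhenomena.CardyFormulaZ2.Cruxes.ParafermionToSLESixFamilies.IicTraceFluxPairing
open Summit.CriticalPhenomena.CardyFormulaZ2.Cruxes.ParafermionToSLESixFamilies.FlipInvolutionReturnLaw
  (IsDiagDir IsDiagFreeWindow IsDiagRectilinear IdentOnDiagRectilinear)

/-! ## §1 Vocabulary of the line (nothing asserted) -/

/-- The CLASS WEIGHT of the corner class `o = f − v ∈ {0, −e₀, −e₀−e₁, −e₁}`: `1, i, −1, −i` (junk `0` on other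
offsets). Read off the landed half-Cauchy–Riemann vertex relation `cornerObs_vertexRelation` / `stub_vertexRelation`
(`χ = i`, corner table `c₀ = (x,x), c₁ = (x+e₀,x), c₂ = (x+e₀,x−e₁), c₃ = (x,x−e₁)`, `E(c₀) − E(c₂) = i (E(c₁) − E(c₃))`):
with these weights the 1-form `β(v,f) := w(f−v)·E(v,f)` on the site–face graph has vanishing circulation
`β(x,f_N) − β(x+e₀,f_N) + β(x+e₀,f_S) − β(x,f_S)` around every interior lattice edge, i.e. it is CLOSED. -/
def classWeight (o : Site 2) : ℂ :=
  if o = 0 then 1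
  else if o = -(Pi.single 0 1 : Site 2) then I
  else if o = -(Pi.single 0 1 : Site 2) - Pi.single 1 1 then -1
  else if o = -(Pi.single 1 1 : Site 2) then -I
  else 0

/-- `(Φ, Ψ)` is an EXACT POTENTIAL PAIR of the datum `E` read at mesh `δ`: `Φ` on sites, `Ψ` on faces, and across every
corner `(v, f)` of an inner face `f` whose site `v` lies on NEITHER discrete arc the increment is the weighted corner
observable, `Φ v − Ψ f = w(f − v) · cornerObs E δ v f`. This is the site–face complex of the INTERIOR sites (for admissible
data `zdBoundary ⊆ A ∪ B`, so every lattice edge between two such sites is a fair coin with two inner faces — exactly the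
hypotheses of the landed vertex relation `cornerObs_vertexRelation`); corners at arc sites are NOT edges of the complex
(at a frozen `B`-site the observable vanishes and the quadrilateral is where the trace jumps; at a wired `A`-site an `A–A`
edge with two inner faces — they occur at the corners of a diamond — is deterministic and closedness genuinely fails). -/
def IsExactPair (E : DiscreteDobrushin) (δ : ℝ) (Φ Ψ : Site 2 → ℂ) : Prop :=
  ∀ v f : Site 2, IsCorner v f → E.IsInnerFace f → v ∉ E.zdArcA → v ∉ E.zdArcB →
    Φ v - Ψ f = classWeight (f - v) * cornerObs E δ v f

/-- The CELLS of the complex: inner faces with at least one corner off both discrete arcs (the faces on which an exact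
pair's `Ψ` is determined, up to one additive constant once the complex is connected; an inner face all of whose corners are
arc sites — the apex pocket of a diamond corner — is not a cell and its `Ψ`-value is junk). -/
def IsCell (E : DiscreteDobrushin) (f : Site 2) : Prop :=
  E.IsInnerFace f ∧ ∃ v : Site 2, IsCorner v f ∧ v ∉ E.zdArcA ∧ v ∉ E.zdArcB

/-- The centre of the face `f` (indexed by its lower-left corner) at mesh `δ`. -/
def ctr (δ : ℝ) (f : Site 2) : ℂ := meshPoint δ f + (δ : ℂ) * (1 + I) / 2

/-- MARKED DIAMONDS: Dobrushin domains whose carrier is an open rectangle with sides parallel to the lattice DIAGONALS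
(centre `c`, half-widths `α, β` in the rotated frame); the two marks are arbitrary boundary points. The witness class of
the line: every side is diagonal, so both halves of the boundary one-arm law come from `IkhlefPonsaingFirstPassage`. -/
def IsMarkedDiamond (D : DobrushinDomain) : Prop :=
  ∃ (c : ℂ) (α β : ℝ), 0 < α ∧ 0 < β ∧
    D.carrier = {z | |((z - c) * exp (-(Real.pi / 4 : ℝ) * I)).re| < α ∧ |((z - c) * exp (-(Real.pi / 4 : ℝ) * I)).im| < β}

/-- `[p, q]` is an ORIENTED BOUNDARY SEGMENT of `D`: a non-degenerate segment of the frontier, no marked point in its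
relative interior, traversed with the domain on its LEFT (`Im((z − p)·conj(q − p)) > 0` for `z ∈ D`; for a convex carrier
this is the counter-clockwise orientation, independent of the orientation of `D.boundary`). -/
def IsBdrySegment (D : DobrushinDomain) (p q : ℂ) : Prop :=
  p ≠ q ∧ segment ℝ p q ⊆ frontier D.carrier ∧ D.pt 0 ∉ openSegment ℝ p q ∧ D.pt 1 ∉ openSegment ℝ p q ∧
    ∀ z ∈ D.carrier, 0 < ((z - p) * (starRingEnd ℂ) (q - p)).im

/-- Coordinate of `z` along the oriented segment `p → q`. -/
def proj (p q z : ℂ) : ℝ := ((z - p) * (starRingEnd ℂ) (q - p)).re / ‖q - p‖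

/-- The SIDE CELLS of the datum `E` at mesh `δ` along `[p, q]`, trimmed by `η` at both ends: cells whose centre lies within
`3δ` of the segment and at distance `≥ η` from `p` and from `q` (three lattice layers: the boundary chain of the potential
and its neighbouring layers, whose values differ from the chain by at most four corner observables). -/
def sideCells (E : DiscreteDobrushin) (δ : ℝ) (p q : ℂ) (η : ℝ) : Set (Site 2) :=
  {f | IsCell E f ∧ infDist (ctr δ f) (segment ℝ p q) ≤ 3 * δ ∧ η ≤ dist (ctr δ f) p ∧ η ≤ dist (ctr δ f) q}

/-- Distance from `x` to the closed ray `ℝ≥0 · τ`. -/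
def rayDist (τ x : ℂ) : ℝ := infDist x ((fun t : ℝ => (t : ℂ) * τ) '' Ici 0)

/-- The renormalised TOUCH MASS of `E` at mesh `δ` carried by the touch sites within `3δ` of `[p, q]` whose coordinate
along the segment lies in `[s, t]`: `δ^{2/3} Σ_x P(x ↔ A)` (`touchSites`, `touchProb` of `…IicDefs`; a finite sum). -/
def touchMass (E : DiscreteDobrushin) (δ : ℝ) (p q : ℂ) (s t : ℝ) : ℝ :=
  δ ^ ((2:ℝ) / 3) * ∑ᶠ x : Site 2,
    ({x ∈ touchSites E | infDist (meshPoint δ x) (segment ℝ p q) ≤ 3 * δ ∧ s ≤ proj p q (meshPoint δ x) ∧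
      proj p q (meshPoint δ x) ≤ t}).indicator (touchProb E) x

/-- The mark indicator of a boundary point (`1` at the two marked points, `0` elsewhere). -/
def markInd (D : DobrushinDomain) (v : ℂ) : ℝ := if v = D.pt 0 ∨ v = D.pt 1 then 1 else 0

/-! ## §2 The statements of the line (each a `def … : Prop`; nothing asserted) -/

/-- **S1 — EXACT POTENTIAL AND ITS BOUNDARY TRACE** (lattice, provable now; Duminil-Copin 2012 Prop. 4–5 for the tree's
`medialExploration` / `bcBondConfig`, winding determinism at boundary corners, finite energy). Along every admissible
discretisation family of a marked diamond:
* (E) eventually in `δ` an exact potential pair exists (closedness of `β = w·E` on the interior site–face complex = the LANDED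
  vertex relation at fair-coin edges with no arc endpoint, plus hole-freeness of the inner-face union: every cycle of the
  complex is a sum of complete quadrilaterals);
* (DIR)+(TURN) there is a unit direction `τ(p,q)` per oriented boundary segment such that, eventually, the renormalised
  face-potential increments between side cells ordered along the segment stay within `C δ^{2/3}` of the ray `ℝ≥0·τ(p,q)`
  (one deterministic phase per side: per touched site the two boundary corners combine to a fixed multiple of the monotone
  touch probability), and consecutive segments `p → v → q` turn by the Schwarz–Christoffel rule of `∫(φ′)^{1/3}`:
  `τ(v,q) = τ(p,v) · exp(i (⅔·∠_v + π/3·[v is a mark]))`, `∠_v = arg((q−v)/(v−p)) ∈ {0, π/2}`;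
* (LOW) on segments of the free arc `D.arc 1` the progress along `τ` dominates the renormalised touch mass strictly between
  the two cells: `c₁ · touchMass − C δ^{2/3} ≤ Re(conj τ · δ^{2/3}(Ψ f′ − Ψ f))` (`c₁ > 0`, `C` absolute).
The exact finite-volume SUM RULE `Σ_s e^{iθ_s} S_s = −1` of the card (certified by exhaustive enumeration at `L = 2, 4`,
kit j020046, and re-derived independently by both round-2 triagers) is the single-valuedness of this potential around the
boundary; (DIR)/(LOW) are its robust, coarse-grained form (additive `O(δ^{2/3})` slack), which is all S4 consumes. -/
def ExactPotentialTrace : Prop :=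
  ∀ (D : DobrushinDomain), IsMarkedDiamond D → ∀ (Λ : ℝ → DiscreteDobrushin), IsFamily D Λ →
    (∀ᶠ δ in 𝓝[>] (0:ℝ), ∃ Φ Ψ : Site 2 → ℂ, IsExactPair (Λ δ) δ Φ Ψ) ∧
    ∃ (τ : ℂ → ℂ → ℂ) (C c₁ : ℝ), 0 < c₁ ∧
      (∀ p q : ℂ, IsBdrySegment D p q → ‖τ p q‖ = 1) ∧
      (∀ p v q : ℂ, IsBdrySegment D p v → IsBdrySegment D v q →
        τ v q = τ p v * exp (((2 / 3 : ℝ) * ((q - v) / (v - p)).arg + (Real.pi / 3) * markInd D v : ℝ) * I)) ∧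
      (∀ p q : ℂ, IsBdrySegment D p q → ∀ η : ℝ, 0 < η → ∀ᶠ δ in 𝓝[>] (0:ℝ), ∀ Φ Ψ : Site 2 → ℂ,
        IsExactPair (Λ δ) δ Φ Ψ → ∀ f f' : Site 2, f ∈ sideCells (Λ δ) δ p q η → f' ∈ sideCells (Λ δ) δ p q η →
          proj p q (ctr δ f) ≤ proj p q (ctr δ f') →
          rayDist (τ p q) (((δ ^ ((2:ℝ) / 3) : ℝ) : ℂ) * (Ψ f' - Ψ f)) ≤ C * δ ^ ((2:ℝ) / 3)) ∧
      (∀ p q : ℂ, IsBdrySegment D p q → segment ℝ p q ⊆ D.arc 1 → ∀ η : ℝ, 0 < η → ∀ᶠ δ in 𝓝[>] (0:ℝ),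
        ∀ Φ Ψ : Site 2 → ℂ, IsExactPair (Λ δ) δ Φ Ψ → ∀ f f' : Site 2, f ∈ sideCells (Λ δ) δ p q η →
          f' ∈ sideCells (Λ δ) δ p q η → proj p q (ctr δ f) ≤ proj p q (ctr δ f') →
          c₁ * touchMass (Λ δ) δ p q (proj p q (ctr δ f) + 3 * δ) (proj p q (ctr δ f') - 3 * δ) - C * δ ^ ((2:ℝ) / 3) ≤
            ((starRingEnd ℂ) (τ p q) * (((δ ^ ((2:ℝ) / 3) : ℝ) : ℂ) * (Ψ f' - Ψ f))).re)

/-- **S2 — DARBOUX–PICARD UNIVALENCE, CONVEX-TARGET FORM** (classical complex analysis, provable now; the identification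
engine; verbatim `Cruxes/ParafermionToSLESixFamilies/SketchIdeator4.lean::DarbouxPicardConvex`, checked TRUE as typed by
both round-2 triagers). A function holomorphic on the unit disc and continuous on the closed disc whose boundary values lie
on the frontier of a compact convex set `K` and wind ONCE, monotonically, around an interior point `w₀` (continuous
non-decreasing argument with total increase `2π`) is injective on the disc and maps it onto `interior K` (argument
principle for `Φ(r·)`, `r → 1`, and the open mapping theorem). Sources: Boas, *Invitation to Complex Analysis* (2010)
§13D/§22D "Darboux's theorem"; Pommerenke, *Boundary Behaviour of Conformal Maps* (1992) §2. -/
def DarbouxPicardConvex : Prop :=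
  ∀ (Φ : ℂ → ℂ) (K : Set ℂ) (w₀ : ℂ) (θ : ℝ → ℝ),
    Convex ℝ K → IsCompact K → w₀ ∈ interior K →
    DifferentiableOn ℂ Φ (ball (0 : ℂ) 1) → ContinuousOn Φ (closedBall (0 : ℂ) 1) →
    MonotoneOn θ (Icc (0 : ℝ) (2 * Real.pi)) → ContinuousOn θ (Icc (0 : ℝ) (2 * Real.pi)) →
    θ (2 * Real.pi) = θ 0 + 2 * Real.pi →
    (∀ t ∈ Icc (0 : ℝ) (2 * Real.pi),
        Φ (exp (t * I)) ∈ frontier K ∧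
        Φ (exp (t * I)) - w₀ = (‖Φ (exp (t * I)) - w₀‖ : ℂ) * exp (θ t * I)) →
    InjOn Φ (ball (0 : ℂ) 1) ∧ Φ '' ball (0 : ℂ) 1 = interior K

/-- **Companion of S2 — NO NEGATIVE WINDING** (argument principle, provable now): for `Φ` holomorphic on the unit disc and
continuous on the closed disc, a continuous argument `θ` of `Φ(e^{it}) − w₀` along the circle (`w₀` omitted by the boundary
values) cannot decrease: `θ(2π) − θ(0) = 2π · #{zeros of Φ − w₀ in the disc} ≥ 0`. S4 uses it to exclude a non-constant
ANTIHOLOMORPHIC potential limit (its conjugate is holomorphic with the lattice trace reflected, i.e. winding `−1`). -/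
def TraceWindingNonneg : Prop :=
  ∀ (Φ : ℂ → ℂ) (w₀ : ℂ) (θ : ℝ → ℝ),
    DifferentiableOn ℂ Φ (ball (0 : ℂ) 1) → ContinuousOn Φ (closedBall (0 : ℂ) 1) →
    ContinuousOn θ (Icc (0 : ℝ) (2 * Real.pi)) →
    (∀ t ∈ Icc (0 : ℝ) (2 * Real.pi),
        Φ (exp (t * I)) ≠ w₀ ∧ Φ (exp (t * I)) - w₀ = (‖Φ (exp (t * I)) - w₀‖ : ℂ) * exp (θ t * I)) →
    θ 0 ≤ θ (2 * Real.pi)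

/-- `G` is a SUBSEQUENTIAL COMPACT-UNIFORM LIMIT, modulo additive constants, of the renormalised face potentials
`u_k^{2/3} Ψ_k` of the data `Λ (u k)` (exact pairs `(Φ_k, Ψ_k)`, shifts `z_k`). -/
def IsPotentialLimit (D : DobrushinDomain) (Λ : ℝ → DiscreteDobrushin) (u : ℕ → ℝ) (G : ℂ → ℂ) : Prop :=
  ∃ (P : ℕ → (Site 2 → ℂ) × (Site 2 → ℂ)) (z : ℕ → ℂ), (∀ k, IsExactPair (Λ (u k)) (u k) (P k).1 (P k).2) ∧
    ∀ K : Set ℂ, IsCompact K → K ⊆ D.carrier → ∀ ε > (0:ℝ), ∀ᶠ k in atTop, ∀ f : Site 2,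
      IsCell (Λ (u k)) f → ctr (u k) f ∈ K → ‖(((u k) ^ ((2:ℝ) / 3) : ℝ) : ℂ) * (P k).2 f - z k - G (ctr (u k) f)‖ ≤ ε

/-- **S3 — CLOSED-DOMAIN PRECOMPACTNESS WITH ONE NON-DEGENERATE SIDE** (the research stub of the line: it carries the
non-degeneracy input N of `Disproof.lean` §4 and the collar). Along every admissible family of a marked diamond:
* (a) COLLAR: the renormalised face potential `δ^{2/3}Ψ` is asymptotically equicontinuous on the cells of the CLOSED diamond,
  boundary layer and marks included (`⇐` 11387's milestone `UniformInnerEnvelope` — X1 — summed radially, `Σ_{R ≤ ρ/δ} R^{-1/3}·δ^{2/3}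
  = O(ρ^{2/3})`, plus the summed SHARP diagonal one-arm upper bound along the trace, from `IkhlefPonsaingFirstPassage`);
* (b′) CLASS STRUCTURE: every subsequential compact-uniform limit of `δ^{2/3}Ψ` (mod constants) is holomorphic OR
  antiholomorphic on the carrier (`⇐` route cruxes #2 `EdgeCoherence` + #3 `EdgePrecompact` by name and the landed
  mode-selection algebra of `CoherentMorera`: character `χ = 1` gives `∫ f dz`, `χ = −1` an antiholomorphic potential,
  `χ = ±i` a locally constant one; the ORIENTATION of the boundary trace, not this stub, selects `χ = 1` — in S4);
* (c) N: some segment of the free arc carries renormalised touch mass `≥ c₀ > 0` eventually (`⇐` the landed conditional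
  `…IicDiagArmLower.diagHalfPlaneOneArmLower_eventually_of_ikhlefPonsaing`, p119507, + RSW/FKG gluing).
Every input is EXTERNAL to crux #5 (a named printed fact, 11387's atom X1, route items 11385/11387); none is a private
sharp-exponent conjecture of this line. Stated unconditionally (a statement about bond percolation on `ℤ²`); a prover lands
the conditional derivation `IkhlefPonsaingFirstPassage → UniformInnerEnvelope → EdgeCoherence → EdgePrecompact → S3` first,
`--supports` the crux. -/
def ClosedPrecompactness : Prop :=
  ∀ (D : DobrushinDomain), IsMarkedDiamond D → ∀ (Λ : ℝ → DiscreteDobrushin), IsFamily D Λ →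
    (∀ ε > (0:ℝ), ∃ η > (0:ℝ), ∀ᶠ δ in 𝓝[>] (0:ℝ), ∀ Φ Ψ : Site 2 → ℂ, IsExactPair (Λ δ) δ Φ Ψ →
      ∀ f f' : Site 2, IsCell (Λ δ) f → IsCell (Λ δ) f' → dist (ctr δ f) (ctr δ f') < η →
        ‖(((δ ^ ((2:ℝ) / 3) : ℝ) : ℂ)) * (Ψ f - Ψ f')‖ ≤ ε) ∧
    (∀ u : ℕ → ℝ, (∀ k, 0 < u k) → Tendsto u atTop (𝓝 0) → ∀ G : ℂ → ℂ, IsPotentialLimit D Λ u G →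
      DifferentiableOn ℂ G D.carrier ∨ DifferentiableOn ℂ (fun z => (starRingEnd ℂ) (G z)) D.carrier) ∧
    (∃ (p q : ℂ) (c₀ : ℝ), IsBdrySegment D p q ∧ segment ℝ p q ⊆ D.arc 1 ∧ 0 < c₀ ∧
      ∀ᶠ δ in 𝓝[>] (0:ℝ), c₀ ≤ touchMass (Λ δ) δ p q (‖q - p‖ / 4) (3 * ‖q - p‖ / 4))

/-- **The conclusion of the identification: `PotentialConformalLimit`** (N + I on diamonds). Along every admissible family
of a marked diamond and every sequence of positive meshes `u_k → 0`: exact pairs exist for all large `k`, and along a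
subsequence the renormalised face potentials converge, modulo additive constants and UNIFORMLY ON THE CLOSED DIAMOND, to a
function `G` holomorphic inside, continuous up to the boundary, with `(G′)³ = c · ψ′/ψ` for EVERY chordal uniformizer
`φ : ℍ → D` (`ψ = φ⁻¹`, `0 ↦ a`, `∞ ↦ b`; `ψ′/ψ = π·(strip map)′` is dilation invariant) and some complex `c ≠ 0` — i.e.
`G = c^{1/3}·∫(π S′_D)^{1/3}` up to a constant: DCS Conj. 8.7 (family form, integrated) on diamonds, with its free-arc boundary
values. The amplitude is complex because the tree's phase `exp(−(i/3)W)` is anchored at the direction of the START dart (a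
global unit factor `e^{iθ(d_a)/3}` whose cube is a lattice direction, not `1`); it may depend on family and subsequence — the
tail uses only `|G′| = |c|^{1/3}|ψ′/ψ|^{1/3} ≠ 0` (the touch-density shape). -/
def PotentialConformalLimit : Prop :=
  ∀ (D : DobrushinDomain), IsMarkedDiamond D → ∀ (Λ : ℝ → DiscreteDobrushin), IsFamily D Λ →
    ∀ u : ℕ → ℝ, (∀ k, 0 < u k) → Tendsto u atTop (𝓝 0) →
      (∀ᶠ k in atTop, ∃ Φ Ψ : Site 2 → ℂ, IsExactPair (Λ (u k)) (u k) Φ Ψ) ∧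
      ∃ (s : ℕ → ℕ) (c : ℂ) (G : ℂ → ℂ), StrictMono s ∧ c ≠ 0 ∧ DifferentiableOn ℂ G D.carrier ∧
        ContinuousOn G (closure D.carrier) ∧
        (∀ φ : ConformalEquiv upperHalfPlaneSet D.carrier, D.IsChordalUniformizing φ → ∀ w ∈ D.carrier,
          deriv G w ^ 3 = c * (deriv (fun x : ℂ => φ.symm x) w / φ.symm w)) ∧
        ∀ ε > (0:ℝ), ∀ᶠ k in atTop, ∀ Φ Ψ : Site 2 → ℂ, IsExactPair (Λ (u (s k))) (u (s k)) Φ Ψ →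
          ∃ z₀ : ℂ, ∀ f : Site 2, IsCell (Λ (u (s k))) f →
            ‖(((u (s k)) ^ ((2:ℝ) / 3) : ℝ) : ℂ) * Ψ f - z₀ - G (ctr (u (s k)) f)‖ ≤ ε

/-! ### Diagonal vocabulary

`IsDiagDir`, `IsDiagFreeWindow`, `IsDiagRectilinear`, `IdentOnDiagRectilinear` are the landed declarations of
`…FlipDefs.lean` (namespace `…FlipInvolutionReturnLaw`), opened above; only the pinned diagonal touch law is new. -/

/-- **`DiagTouchLawPosPin D`** — the SLIT-UNIFORM PINNED TOUCH LAW of `…IicTouchLawPin.TouchLawPosPin`, VERBATIM except that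
the windows are flat DIAGONAL free windows (`IsDiagFreeWindow`). For every admissible family, window and mesh sequence: ONE
subsequence and ONE amplitude `c > 0` such that for all test functions `g` in the window box and all `r, ε > 0`, for all
large `k` and EVERY exploration prefix `γ[0, n+1]` staying `r`-away from the closed box, the pinned touch functional `N` of the
revealed data satisfies `|N − c ∫ g ρ ds| ≤ ε` with `ρ` the covariant weight-`1/3` density of the slit component
`(U; tip, b_δ)` pushed onto `∂U` (ACTIVE window), and `|N| ≤ ε` for a SEALED window. This is the slit uniformity U of the
crux in the vocabulary closed under slitting (pinned data), the hypothesis the Doob-martingale identification consumes. -/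
def DiagTouchLawPosPin (D : DobrushinDomain) : Prop :=
  ∀ (Λ : ℝ → DiscreteDobrushin) (hΛ : IsFamily D Λ) (m η : ℂ) (a b : ℝ), IsDiagFreeWindow D m η a b →
    ∀ u : ℕ → ℝ, Tendsto u atTop (𝓝[>] (0:ℝ)) →
      ∃ (s : ℕ → ℕ) (c : ℝ), StrictMono s ∧ 0 < c ∧
        ∀ g : ℂ → ℝ, Continuous g → HasCompactSupport g →
          tsupport g ⊆ {z | |tCoord m η z| < a ∧ |nCoord m η z| < b} →
          ∀ r ε : ℝ, 0 < r → 0 < ε →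
            ∀ᶠ k : ℕ in atTop, ∀ (hδ : (Λ (u (s k))).IsZdAdmissible) (ω₀ : BondConfig (Site 2)) (n : ℕ),
              n < exitTime hδ ω₀ →
              (∀ z ∈ prefixTrace (Λ (u (s k))) n ω₀, ∀ w : ℂ,
                |tCoord m η w| ≤ a → |nCoord m η w| ≤ b → r ≤ dist z w) →
              let U : Set ℂ := connectedComponentIn
                ((familyFaceDomain hΛ.zd hδ).carrier \ prefixTrace (Λ (u (s k))) n ω₀) (m + ((b / 2 : ℝ) : ℂ) * η)
              let N : ℝ := touchFunctionalPin (Λ (u (s k))) (ω₀ ∩ revealedFreeEdges hδ ω₀ n)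
                (revealedFreeEdges hδ ω₀ n \ ω₀) g
              (tipAccess (Λ (u (s k))) n ω₀ ⊆ U →
                ∃ (ρ : ℂ → ℝ) (d : ℝ), 0 ≤ d ∧ d ≤ u (s k) ∧
                  (∀ y : ℂ, |tCoord m η y| < a → nCoord m η y = 0 →
                    HasPinTouchDensityAt U (tipAccess (Λ (u (s k))) n ω₀) (prefixTip (Λ (u (s k))) n ω₀)
                      ((familyFaceDomain hΛ.zd hδ).pt 1) (y + (d : ℂ) * η) (ρ y)) ∧
                  |N - c * ∫ t in Set.Ioo (-a) a,
                      g (m + (t : ℂ) * (Complex.I * η)) * ρ (m + (t : ℂ) * (Complex.I * η))| ≤ ε) ∧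
              (¬ tipAccess (Λ (u (s k))) n ω₀ ⊆ U → |N| ≤ ε)

/-! ## §3 Non-vacuity check (sorry-free) -/

/-- The class weights are unimodular on the four corner classes (the values `1, i, −1, −i`). -/
theorem norm_classWeight_of_isCorner : ∀ {v f : Site 2}, IsCorner v f → ‖classWeight (f - v)‖ = 1 := by
  intro v f h
  have h0 := h 0
  have h1 := h 1
  have key : f - v = 0 ∨ f - v = -(Pi.single 0 1 : Site 2) ∨ f - v = -(Pi.single 0 1 : Site 2) - Pi.single 1 1 ∨
      f - v = -(Pi.single 1 1 : Site 2) := by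
    rcases h0 with h0 | h0 <;> rcases h1 with h1 | h1
    · left; ext i; fin_cases i <;> simp [h0, h1]
    · right; right; right; ext i; fin_cases i <;> simp [h0, h1]
    · right; left; ext i; fin_cases i <;> simp [h0, h1]
    · right; right; left; ext i; fin_cases i <;> simp [h0, h1]
  have hne1 : (-(Pi.single 0 1 : Site 2)) ≠ 0 := by
    intro h; have := congr_fun h 0; simp at this
  have hne2 : (-(Pi.single 0 1 : Site 2) - Pi.single 1 1) ≠ 0 := by
    intro h; have := congr_fun h 0; simp at this
  have hne3 : (-(Pi.single 0 1 : Site 2) - Pi.single 1 1) ≠ -(Pi.single 0 1 : Site 2) := by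
    intro h; have := congr_fun h 1; simp at this
  have hne4 : (-(Pi.single 1 1 : Site 2)) ≠ 0 := by
    intro h; have := congr_fun h 1; simp at this
  have hne5 : (-(Pi.single 1 1 : Site 2)) ≠ -(Pi.single 0 1 : Site 2) := by
    intro h; have := congr_fun h 1; simp at this
  have hne6 : (-(Pi.single 1 1 : Site 2)) ≠ -(Pi.single 0 1 : Site 2) - Pi.single 1 1 := by
    intro h; have := congr_fun h 0; simp at this
  rcases key with hk | hk | hk | hk <;> simp [classWeight, hk, hne1, hne2, hne3, hne4, hne5, hne6]

/-! ## §4 Reshape r2 of the line (lead c5, after wave 1; statements only, nothing asserted)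

Wave 1 landed (E) (`exists_isExactPair`, `eventually_exists_isExactPair`, p138726) and found, by exact enumeration of the
tree's exploration rules on `R = 3, 4` diamonds (worker a86c…, evidence in the lead's folder `work/stubs/scratch/`), that
(DIR)/(LOW) of `ExactPotentialTrace` are FALSE AS TYPED for one reason only: `cornerObs` measures windings relative to the
first exploration dart out of `e_a`, whose lattice direction is not controlled along an admissible family (the index of the
start corner flips with the parity of the discrete mark as `δ → 0`), so the whole lattice trace carries a global unimodular
factor `e^{± iπ/6}` depending on `δ`; with a mesh-dependent unit PHASE ANCHOR `u δ` everything else checks out exactly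
(free sides: increments `√3 · P(u ↔ A) ·` fixed unit vector; TURN constants `e^{iπ/3}` at the four corners and at both
marks). On WIRED sides the per-site increments of the interior chain are not aligned, but the increments of the potential
extended to the first layer of `A`-sites are (block structure of the three `A`-corner darts of a tip cell) — which needs the
vertex relation at fair-coin edges with ONE endpoint on the wired arc, true in exact enumeration (defect `≤ 2·10⁻¹⁰`) and
not covered by the landed `cornerObs_vertexRelation` (both endpoints off both arcs). Hence two statements:
`VertexRelationArcA` (new stub S1v) and `ExactPotentialTracePh` (S1′, replacing S1; S4′ consumes it — the complex
amplitude `c` of `PotentialConformalLimit` absorbs the anchor along a subsequence with `u (u_k) → u⋆`). -/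

/-- **S1v — THE VERTEX RELATION AT INTERIOR–WIRED-ARC EDGES** (lattice; exact enumeration defect `≤ 2·10⁻¹⁰` on `R = 3, 4`
diamonds; unproved). Verbatim the landed `EdgePrecompact.QkzStripBoundaryArm.cornerObs_vertexRelation` (Jordan carrier,
admissible datum, `e = cTgt p` an edge of `Ω_δ`, both faces at `e` inner, `χ = i`:
`E(oX) − E(oY) = i (E(p₂) − E(p))` for the two corners leaving `e` and the two arriving at it, `p₂ = cornerPartner p =
(p.1 + cornerUnit (p.2+1), p.2+2)`), EXCEPT that the hypothesis "both endpoints of `e` off both arcs" is weakened to "no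
endpoint on the free arc `B` and not both endpoints on the wired arc `A`" — i.e. `e` is still a fair coin of
`bcBondConfig`, but one endpoint may be a wired-arc site (whose other faces need not be inner). The involution
`ω ↦ ω △ {e}` argument is local (bouncing never leaves the current face); the tree's proof uses "all four faces around both
endpoints inner" (`forall_isInnerFace_of_not_mem_arcs`) and has to be re-run without it. -/
def VertexRelationArcA : Prop :=
  ∀ (D : DobrushinDomain) (E : DiscreteDobrushin), E.Ω = D.carrier → E.IsZdAdmissible →
    ∀ p : Site 2 × Fin 4, cTgt p ∈ (discreteDomainGraph E.Ω E.δ).edgeSet →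
      (∀ y ∈ cTgt p, y ∉ E.zdArcB) → (∃ y ∈ cTgt p, y ∉ E.zdArcA) →
      E.IsInnerFace (cFace p) → E.IsInnerFace (faceAt p.1 (p.2 + 1)) →
      cornerObs E E.δ p.1 (cFace (p.1, p.2 + 1)) -
          cornerObs E E.δ (p.1 + cornerUnit (p.2 + 1)) (cFace (p.1 + cornerUnit (p.2 + 1), p.2 + 3)) =
        I * (cornerObs E E.δ (p.1 + cornerUnit (p.2 + 1)) (faceAt (p.1 + cornerUnit (p.2 + 1)) (p.2 + 2)) -
          cornerObs E E.δ p.1 (cFace p))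

/-- **S1′ — EXACT POTENTIAL AND ITS PHASE-ANCHORED BOUNDARY TRACE** (reshape of `ExactPotentialTrace` after wave 1):
verbatim `ExactPotentialTrace` except that the ray direction in (DIR)/(LOW) is `u δ · τ(p,q)` with a mesh-dependent global
unimodular PHASE ANCHOR `u δ` (the cube root of the direction of the first exploration dart out of `e_a`, whose parity is
not controlled by `IsFamily`); (E) and (TURN) are unchanged. Checked in exact enumeration on `R = 3, 4` diamonds: free-side
increments `√3·P(u ↔ A)·(unit vector constant along the side)`, all six turns `+60°`, LOW with `c₁ ≤ √3/5`; the wired-side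
DIR needs `VertexRelationArcA`. -/
def ExactPotentialTracePh : Prop :=
  ∀ (D : DobrushinDomain), IsMarkedDiamond D → ∀ (Λ : ℝ → DiscreteDobrushin), IsFamily D Λ →
    (∀ᶠ δ in 𝓝[>] (0:ℝ), ∃ Φ Ψ : Site 2 → ℂ, IsExactPair (Λ δ) δ Φ Ψ) ∧
    ∃ (τ : ℂ → ℂ → ℂ) (u : ℝ → ℂ) (C c₁ : ℝ), 0 < c₁ ∧ (∀ δ : ℝ, ‖u δ‖ = 1) ∧
      (∀ p q : ℂ, IsBdrySegment D p q → ‖τ p q‖ = 1) ∧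
      (∀ p v q : ℂ, IsBdrySegment D p v → IsBdrySegment D v q →
        τ v q = τ p v * exp (((2 / 3 : ℝ) * ((q - v) / (v - p)).arg + (Real.pi / 3) * markInd D v : ℝ) * I)) ∧
      (∀ p q : ℂ, IsBdrySegment D p q → ∀ η : ℝ, 0 < η → ∀ᶠ δ in 𝓝[>] (0:ℝ), ∀ Φ Ψ : Site 2 → ℂ,
        IsExactPair (Λ δ) δ Φ Ψ → ∀ f f' : Site 2, f ∈ sideCells (Λ δ) δ p q η → f' ∈ sideCells (Λ δ) δ p q η →
          proj p q (ctr δ f) ≤ proj p q (ctr δ f') →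
          rayDist (u δ * τ p q) (((δ ^ ((2:ℝ) / 3) : ℝ) : ℂ) * (Ψ f' - Ψ f)) ≤ C * δ ^ ((2:ℝ) / 3)) ∧
      (∀ p q : ℂ, IsBdrySegment D p q → segment ℝ p q ⊆ D.arc 1 → ∀ η : ℝ, 0 < η → ∀ᶠ δ in 𝓝[>] (0:ℝ),
        ∀ Φ Ψ : Site 2 → ℂ, IsExactPair (Λ δ) δ Φ Ψ → ∀ f f' : Site 2, f ∈ sideCells (Λ δ) δ p q η →
          f' ∈ sideCells (Λ δ) δ p q η → proj p q (ctr δ f) ≤ proj p q (ctr δ f') →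
          c₁ * touchMass (Λ δ) δ p q (proj p q (ctr δ f) + 3 * δ) (proj p q (ctr δ f') - 3 * δ) - C * δ ^ ((2:ℝ) / 3) ≤
            ((starRingEnd ℂ) (u δ * τ p q) * (((δ ^ ((2:ℝ) / 3) : ℝ) : ℂ) * (Ψ f' - Ψ f))).re)

/-- The phase-anchored trace statement is implied by the original one (anchor `u ≡ 1`): the reshape only WEAKENS S1. -/
theorem exactPotentialTracePh_of_exactPotentialTrace : ExactPotentialTrace → ExactPotentialTracePh := by
  intro h D hD Λ hΛ
  obtain ⟨hE, τ, C, c₁, hc₁, hτ, hturn, hdir, hlow⟩ := h D hD Λ hΛ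
  refine ⟨hE, τ, fun _ => 1, C, c₁, hc₁, fun _ => by simp, hτ, hturn, ?_, ?_⟩
  · intro p q hpq η hη
    filter_upwards [hdir p q hpq η hη] with δ hδ Φ Ψ hP f f' hf hf' hle
    simpa only [one_mul] using hδ Φ Ψ hP f f' hf hf' hle
  · intro p q hpq hsub η hη
    filter_upwards [hlow p q hpq hsub η hη] with δ hδ Φ Ψ hP f f' hf hf' hle
    simpa only [one_mul] using hδ Φ Ψ hP f f' hf hf' hle

end Summit.CriticalPhenomena.CardyFormulaZ2.Cruxes.ParafermionToSLESixFamilies.PotentialDarbouxPicardDiamond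

end
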